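import Mathlib
import Literature.Probability.Percolation.PercolationProofs
import Summits.CriticalPhenomena.PercolationContinuityZ3.Theorems.PercNearOneGluingAdditiveGluingGoodPocketMarkov
import Summits.CriticalPhenomena.PercolationContinuityZ3.Theorems.PercNearOneGluingAdditiveGluingGoodBase
import Summits.CriticalPhenomena.PercolationContinuityZ3.Theorems.PercNearOneGluingAdditiveGluingLemma5AnyRelay
import HarnessLib

/-! # Crux `PercNearOneGluing.AdditiveGluing` (stmt-CriticalPhenomena-4576), line `subuniform-dead-pocket-maximum` —
the bottom layer `|A ∖ b| ≤ 1` of the induction on the relay set (siege k22)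

Goodness (Kozma–Nitzan arXiv:2401.12397 §3.2, skeleton selection form) of every quadruple whose relay set is contained
in a pair `{a, b}` ∋ `b`: unconditionally, for every weight function, observer, level and selection.  With the summed
dead-pocket Markov identity (`goodPM_sum_pocket_markov`) the penalty is at most `μ(o ↮ A, a ↮ b)`, the live failure
`μ(o ↔ a, o ↮ b)` lies in `{o ↔ A, a ↮ b}`, and the two add up to at most `μ(a ↮ b) ≤ t`.  This is the layer
`k = |A ∖ b| ≤ 1` of the census in `…GoodSaturation.lean`; the layer `k = 2` is the lead's kernel C1 and `k ≥ 3`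
contains Kozma–Nitzan's Question 7.  Registered sub-goal proved by name: `stub_goodPairLayer_k22`.  No new definitions. -/

namespace Summit.CriticalPhenomena.PercolationContinuityZ3.Theorems

open MeasureTheory Set
open Literature.Probability.LatticeModels (prodBernoulli)
open Literature.Probability.Percolation (BondConfig openConn openConnIn openGraph openCluster)
open scoped BigOperators

noncomputable section
open Classical

variable {n : ℕ}

/-- `{b ↔ b in S}` is the sure event when `b ∈ S`. [folklore] -/
theorem goodPL_openConnIn_self (S : Set (Fin n)) (b : Fin n) (hb : b ∈ S) :
    (openConnIn S b b : Set (BondConfig (Fin n))) = Set.univ :=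
  Set.eq_univ_of_forall fun _ => ⟨hb, hb, SimpleGraph.Reachable.refl _⟩

/-- **Goodness for relay sets inside a pair `{a, b}`** (the layer `|A ∖ b| ≤ 1`): for `b ∈ A ⊆ {a, b}`, `o ∉ A`, every
level `t` with `1 − t ≤ μ(x ↔ b)` on `A` and every selection into `A` (any observer `o`),
`μ(o ↔ A, o ↮ b) + Σ_{W ∋ o, W ∩ A = ∅} μ(C(o) = W) · μ((sel W ↔ b in Wᶜ)ᶜ) ≤ t`.
[Kozma–Nitzan arXiv:2401.12397 §3.2; elementary] -/
theorem goodPL_of_subset_pair (w : Sym2 (Fin n) → unitInterval) (A : Finset (Fin n)) (o b a : Fin n)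
    (hA : A ⊆ {a, b}) (hbA : b ∈ A) (t : ℝ) (sel : Finset (Fin n) → Fin n)
    (hsel : ∀ W, sel W ∈ A) (hrel : ∀ x ∈ A, 1 - t ≤ (prodBernoulli w).real (openConn x b)) :
    (prodBernoulli w).real ((⋃ x ∈ A, openConn o x) ∩ (openConn o b)ᶜ)
      + ∑ W ∈ (Finset.univ : Finset (Finset (Fin n))).filter (fun W => o ∈ W ∧ Disjoint W A),
          (prodBernoulli w).real {ω : BondConfig (Fin n) | openCluster ω o = (W : Set (Fin n))}
            * (prodBernoulli w).real (openConnIn ((W : Set (Fin n))ᶜ) (sel W) b)ᶜ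
      ≤ t := by
  have ht0 : 0 ≤ t := by
    have h := hrel b hbA
    have h1 : (prodBernoulli w).real (openConn b b) ≤ 1 := measureReal_le_one
    linarith
  -- the `b`-selected terms vanish
  have hbterm : ∀ W ∈ (Finset.univ : Finset (Finset (Fin n))).filter (fun W => o ∈ W ∧ Disjoint W A),
      sel W = b → (prodBernoulli w).real (openConnIn ((W : Set (Fin n))ᶜ) (sel W) b)ᶜ = 0 := by
    intro W hW hselb
    have hbW : b ∉ W := fun h => Finset.disjoint_left.1 (Finset.mem_filter.1 hW).2.2 h hbA
    rw [hselb, goodPL_openConnIn_self ((W : Set (Fin n))ᶜ) b (fun h => hbW (Finset.mem_coe.1 h)),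
      Set.compl_univ, measureReal_empty]
  -- degenerate case `A = {b}`: everything vanishes
  have hdeg : (∀ x ∈ A, x = b) →
      (prodBernoulli w).real ((⋃ x ∈ A, openConn o x) ∩ (openConn o b)ᶜ)
        + ∑ W ∈ (Finset.univ : Finset (Finset (Fin n))).filter (fun W => o ∈ W ∧ Disjoint W A),
            (prodBernoulli w).real {ω : BondConfig (Fin n) | openCluster ω o = (W : Set (Fin n))}
              * (prodBernoulli w).real (openConnIn ((W : Set (Fin n))ᶜ) (sel W) b)ᶜ ≤ t := by
    intro hAb
    have hlive : (prodBernoulli w).real ((⋃ x ∈ A, openConn o x) ∩ (openConn o b)ᶜ) = 0 := by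
      have hempty : (⋃ x ∈ A, (openConn o x : Set (BondConfig (Fin n)))) ∩ (openConn o b)ᶜ = ∅ := by
        ext ω
        simp only [Set.mem_inter_iff, Set.mem_iUnion, exists_prop, Set.mem_compl_iff, Set.mem_empty_iff_false,
          iff_false, not_and, not_not]
        rintro ⟨x, hx, hωx⟩
        rwa [hAb x hx] at hωx
      rw [hempty, measureReal_empty]
    have hpen : ∑ W ∈ (Finset.univ : Finset (Finset (Fin n))).filter (fun W => o ∈ W ∧ Disjoint W A),
        (prodBernoulli w).real {ω : BondConfig (Fin n) | openCluster ω o = (W : Set (Fin n))}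
          * (prodBernoulli w).real (openConnIn ((W : Set (Fin n))ᶜ) (sel W) b)ᶜ = 0 :=
      Finset.sum_eq_zero fun W hW => by rw [hbterm W hW (hAb _ (hsel W)), mul_zero]
    linarith
  by_cases hmain : a ∈ A ∧ a ≠ b
  swap
  · refine hdeg fun x hx => ?_
    have h : x = a ∨ x = b := by simpa using hA hx
    rcases h with rfl | h
    · by_contra hxb
      exact hmain ⟨hx, hxb⟩
    · exact h
  obtain ⟨haA, hab⟩ := hmain
  -- main case: `a ∈ A`, `a ≠ b`
  have hpen : ∑ W ∈ (Finset.univ : Finset (Finset (Fin n))).filter (fun W => o ∈ W ∧ Disjoint W A),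
      (prodBernoulli w).real {ω : BondConfig (Fin n) | openCluster ω o = (W : Set (Fin n))}
        * (prodBernoulli w).real (openConnIn ((W : Set (Fin n))ᶜ) (sel W) b)ᶜ ≤
      ∑ W ∈ (Finset.univ : Finset (Finset (Fin n))).filter (fun W => o ∈ W ∧ Disjoint W A),
        (prodBernoulli w).real {ω : BondConfig (Fin n) | openCluster ω o = (W : Set (Fin n))}
          * (prodBernoulli w).real (openConnIn ((W : Set (Fin n))ᶜ) a b)ᶜ := by
    refine Finset.sum_le_sum fun W hW => mul_le_mul_of_nonneg_left ?_ measureReal_nonneg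
    have hs : sel W = a ∨ sel W = b := by simpa using hA (hsel W)
    rcases hs with hs | hs
    · rw [hs]
    · rw [hbterm W hW hs]
      exact measureReal_nonneg
  rw [goodPM_sum_pocket_markov w A o b a b hbA haA] at hpen
  -- the live failure lies in `{o ↔ A} ∩ {a ↮ b}`
  have hlive : (prodBernoulli w).real ((⋃ x ∈ A, openConn o x) ∩ (openConn o b)ᶜ) ≤
      (prodBernoulli w).real ((⋃ x ∈ A, (openConn o x : Set (BondConfig (Fin n)))) ∩ (openConn a b)ᶜ) := by
    refine measureReal_mono ?_
    rintro ω ⟨hU, hB⟩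
    refine ⟨hU, fun hab' => hB ?_⟩
    simp only [Set.mem_iUnion, exists_prop] at hU
    obtain ⟨x, hx, hωx⟩ := hU
    have hxab : x = a ∨ x = b := by simpa using hA hx
    rcases hxab with rfl | rfl
    · exact (show (openGraph ω).Reachable o x from hωx).trans hab'
    · exact hωx
  have hsum : (prodBernoulli w).real ((⋃ x ∈ A, (openConn o x : Set (BondConfig (Fin n)))) ∩ (openConn a b)ᶜ)
      + (prodBernoulli w).real ((⋃ x ∈ A, (openConn o x : Set (BondConfig (Fin n))))ᶜ ∩ (openConn a b)ᶜ) =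
      (prodBernoulli w).real (openConn a b : Set (BondConfig (Fin n)))ᶜ := by
    rw [← measureReal_union (Set.disjoint_left.2 fun ω h1 h2 => h2.1 h1.1) (Set.toFinite _).measurableSet]
    congr 1
    ext ω
    simp only [Set.mem_union, Set.mem_inter_iff, Set.mem_compl_iff]
    tauto
  have hcompl : (prodBernoulli w).real (openConn a b : Set (BondConfig (Fin n)))ᶜ =
      1 - (prodBernoulli w).real (openConn a b) :=
    probReal_compl_eq_one_sub (Set.toFinite _).measurableSet
  have hra := hrel a haA
  linarith

/-- **Goodness when every low neighbour of the observer is level-reliable** (KN Thm 4's class enlarged by the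
monotonicity `goodSat_mono`): if every `y ∉ A`, `y ≠ o` with `w s(o,y) ≠ 0` satisfies `1 − t ≤ μ(y ↔ b)`, the goodness
inequality holds at level `t` for every selection.  Proof: if `1 − t ≤ μ(o ↔ b)` use the high observer; otherwise
saturate `A` by the super-level set — the observer becomes isolated off the relay set, which is `stub_goodBase` (with
`stub_lemma5AnyRelay`) — and descend by `goodSat_mono`.  So the first case of `stub_goodStep` not covered by the landed
stubs is an observer with a low neighbour OUTSIDE the super-level set. [Kozma–Nitzan arXiv:2401.12397 Thm 4, §5.6 (4)] -/
theorem goodPL_of_reliable_low_neighbours (w : Sym2 (Fin n) → unitInterval) (A : Finset (Fin n)) (o b : Fin n)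
    (hbA : b ∈ A) (hoA : o ∉ A) (t : ℝ)
    (hlow : ∀ y : Fin n, y ∉ A → y ≠ o → (w s(o, y) : ℝ) ≠ 0 → 1 - t ≤ (prodBernoulli w).real (openConn y b))
    (hrel : ∀ x ∈ A, 1 - t ≤ (prodBernoulli w).real (openConn x b))
    (sel : Finset (Fin n) → Fin n) (hsel : ∀ W, sel W ∈ A) :
    (prodBernoulli w).real ((⋃ x ∈ A, openConn o x) ∩ (openConn o b)ᶜ)
      + ∑ W ∈ (Finset.univ : Finset (Finset (Fin n))).filter (fun W => o ∈ W ∧ Disjoint W A),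
          (prodBernoulli w).real {ω : BondConfig (Fin n) | openCluster ω o = (W : Set (Fin n))}
            * (prodBernoulli w).real (openConnIn ((W : Set (Fin n))ᶜ) (sel W) b)ᶜ
      ≤ t := by
  by_cases ho : 1 - t ≤ (prodBernoulli w).real (openConn o b)
  · exact goodSat_of_le_observer w A o b hbA t sel ho
  push Not at ho
  set A' : Finset (Fin n) := A ∪ Finset.univ.filter (fun x : Fin n =>
    1 - t ≤ (prodBernoulli w).real (openConn x b)) with hA'
  have hAA' : A ⊆ A' := Finset.subset_union_left
  have hoA' : o ∉ A' := by
    rw [hA', Finset.mem_union, Finset.mem_filter]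
    rintro (h | ⟨-, h⟩)
    · exact hoA h
    · exact absurd h (not_le.2 ho)
  have hrelA' : ∀ a ∈ A', 1 - t ≤ (prodBernoulli w).real (openConn a b) := by
    intro a ha
    rw [hA', Finset.mem_union, Finset.mem_filter] at ha
    rcases ha with ha | ⟨-, ha⟩
    · exact hrel a ha
    · exact ha
  have hiso : ∀ y : Fin n, y ∉ A' → y ≠ o → (w s(o, y) : ℝ) = 0 := by
    intro y hy hyo
    by_contra hw
    have hyA : y ∉ A := fun h => hy (hAA' h)
    exact hy (Finset.mem_union_right _ (Finset.mem_filter.2 ⟨Finset.mem_univ _, hlow y hyA hyo hw⟩))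
  exact goodSat_mono w A' A o b hAA' hbA t
    (fun sel' hsel' => stub_goodBase stub_lemma5AnyRelay n w A' o b (hAA' hbA) hoA' hiso t sel' hsel' hrelA') sel hsel

/-- **Registered sub-goal `stub_goodPairLayer_k22`** (closed form of `goodPL_of_subset_pair`): the layer `|A ∖ b| ≤ 1`
of the goodness inequality holds unconditionally. (Kozma–Nitzan arXiv:2401.12397 §3.2.) -/
theorem stub_goodPairLayer_k22 : ∀ (n : ℕ) (w : Sym2 (Fin n) → unitInterval) (A : Finset (Fin n)) (o b a : Fin n), A ⊆ {a, b} → b ∈ A → ∀ (t : ℝ) (sel : Finset (Fin n) → Fin n), (∀ W, sel W ∈ A) → (∀ x ∈ A, 1 - t ≤ (prodBernoulli w).real (openConn x b)) → (prodBernoulli w).real ((⋃ x ∈ A, openConn o x) ∩ (openConn o b)ᶜ) + ∑ W ∈ (Finset.univ : Finset (Finset (Fin n))).filter (fun W => o ∈ W ∧ Disjoint W A), (prodBernoulli w).real {ω : BondConfig (Fin n) | openCluster ω o = (W : Set (Fin n))} * (prodBernoulli w).real (openConnIn ((W : Set (Fin n))ᶜ) (sel W) b)ᶜ ≤ t :=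 by
  intro n w A o b a hA hbA t sel hsel hrel
  exact goodPL_of_subset_pair w A o b a hA hbA t sel hsel hrel

end

end Summit.CriticalPhenomena.PercolationContinuityZ3.Theorems
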